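import Mathlib
import HarnessLib
import Literature.MathematicalPhysics.StatisticalMechanics.TunedInitialConditionTorusFRD

/-!
# [ABKM19] — the renormalisation-group PACKAGE telescope bundled, and the `q`-regularity SLOTS of
# Lemma 12.6 / Lemma 8.4 / Theorem 6.8 as named `Prop`s (`N`-uniform sizes by quantifier order)

[ABKM19] (Adams–Buchholz–Kotecký–Müller, arXiv:1910.13564) run the renormalisation-group map of Theorem 6.8
for the family of finite-range decompositions `𝒞_{1+q,·}` of the tuned covariances, `q` a small symmetric
`d × d` matrix, and use in Lemma 12.6 ((12.51)–(12.53)) and Lemma 8.4 that the step operators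
`A_q⁻¹, B_q, S_q` and the last-scale functional `Φ_q` are Lipschitz (`ℓ = 1`) and have bounded mixed second
differences (`ℓ = 2`) in `q`, with constants UNIFORM IN THE HEIGHT `N` of the torus `(ℤ/L^N)^d`
([Buc16] Thm 2.4 / Thm 4.5 supply the `q`-smooth decomposition with the regularity gap `d + 1 ≤ 2(ñ − n)`).
The tree proves these slot by slot (`norm_rgA_symm_one_add_sub_le_of_torusFRD`,
`norm_rgA_symm_secondDiff_le_of_torusFRD`, `norm_rgBQ_sub_le_unif_of_torusFRD`,
`norm_integral_last_kernel_sub_le_of_torusFRD`, `exists_activityNormLE_rgSQ_sub_of_torusFRD` (the last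
with an `N`-dependent constant so far), …) over the 45-binder package telescope of
`exists_tuned_initial_of_torusFRD`.  This file only NAMES things:

* `PackageData d`, `PackageAt P N M` — pure BUNDLING (no claim) of the `N`-free data / side conditions and of
  the height-`N` torus data of ONE package, i.e. the binder telescope of
  `GradientRG.exists_tuned_initial_of_torusFRD` (through `hc2A`) plus the regularity gap `hgap`, so that
  every slot below is a short named `Prop` over `(P, Q)` and a slot theorem reads `∀ P, ∃ size, ∀ N M Q, …`;
* the abbreviations of record `Q.normParams`, `Q.kernels q = 𝒞_{1+q,·}`, `Q.opB q k = B_k^{(q)}` (`rgBT`),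
  `Q.opS q k = S_k^{(q)}` (`rgSQ`), `Q.lastScale q y = ∫ y(Λ_N) dμ_{𝒞_{1+q,N+1}}`, the ball `P.InBall q`
  (`q` symmetric, `Σ|q_ij| ≤ T₀`) and the entry sum `esum`;
* the nine `q`-SLOTS `F4a F4b F4l F4a2 F4b2 F4l2 F4l' F4Φ2 F4Φ22` ((12.51)–(12.53) at `ℓ = 1, 2`, the mixed
  `q`/state slot, the last scale) and the STATE SLOT `H1σ2` (joint second differences of `(u, v) ↦ S_q(u, v)`,
  Theorem 6.8 smoothness), each a `Prop` in a FREE size variable — verbatim the families fixed in the cell memo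
  `F4-H1BC-SIGNATURES-cgffstiff1-g12` (§0–§3, §5) of the programme using them;
* the NAMED FACTS (unproved here; used as hypotheses / route children) `F4Statement d` (all nine slots with
  `N`-free sizes), `H1bcStatement d` (`H1σ2` with an `N`-free size), `TwoKernelSkBound d` ((12.53) = `F4l`
  ALONE with an `N`-free size: the Banach-grade two-kernel `S_k` comparison) and `L2GaussianCore d` (the two
  `ℓ = 2` slots `F4b2`, `F4Φ22` that need only the second-order Gaussian fluctuation engine).

Use (honest scope): these are the by-name children of the planner's split of the cruxes `HypACumulant` /
`HypALocalTwoPoint` of the route `Summits/HubbardSuperconductivity/…/Theses/ComplexGFFStiffness` (rung H2gff /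
1c: stiffness of a complex Gaussian gradient field; nothing about superconductivity in the Hubbard model is
claimed or advanced here).  Definitions only; NOTHING in this file is asserted.

## References
* S. Adams, S. Buchholz, R. Kotecký, S. Müller, *Cauchy–Born rule from microscopic models with non-convex
  potentials*, arXiv:1910.13564 — Thm 6.8, Thm 7.1, Lemma 8.4, Lemma 12.6 (12.51)–(12.53)
  [AdamsBuchholzKoteckyMuller2019].
* S. Buchholz, *Finite range decomposition for Gaussian measures with improved regularity*, J. Funct. Anal.
  275 (2018) 1674–1711, Thm 2.4 / Thm 4.5 [Buchholz2016].
-/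

noncomputable section

namespace Literature.MathematicalPhysics.StatisticalMechanics.GradientRG

open scoped BigOperators
open _root_.MeasureTheory
open Literature.MathematicalPhysics.StatisticalMechanics.GradientFRD
  (fourierCoeff IsElliptic IsUnitSymm InShell iterDiff supNorm conv ellOp)

/-! ## The package telescope, bundled -/

/-- **`PackageData d`** — the `N`-FREE data and side conditions of one [ABKM19] renormalisation-group
package on the tori `(ℤ/L^N)^d`: verbatim the binders of `GradientRG.exists_tuned_initial_of_torusFRD`
that do not depend on the height `N` (`L, M_ord, R, n, ñ, p_Φ, r₀`, the weight schedule `θ̄, λ, μ, δ₁, δ₀,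
A_𝒫`, the decomposition constants `c, C, C_ℓ, C_α`, the field weight `h`, the tuning ball `θ, T₀`,
`A_𝒫' = A_𝒫(θ)`, the large-set constant `A`, the state-ball radius `r` of Theorem 6.8 / Ch. 12, and the
side conditions `hd … hc2A` of `RGStepABKMQ`), plus the regularity gap `hgap : d + 1 ≤ 2(ñ − n)` used by
every `N`-uniform `q`-slot ([Buc16] proof of Thm 4.5).  Pure bundling: a child statement quantifies
`∀ P : PackageData d` instead of a 45-binder telescope. [cite: AdamsBuchholzKoteckyMuller2019, Thm 6.8 / Lemma 12.6] -/
structure PackageData (d : ℕ) where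
  L : ℕ
  Mord : ℕ
  R : ℕ
  n : ℕ
  ñ : ℕ
  pT : ℕ
  r₀ : ℕ
  θbar : ℝ
  lam : ℝ
  μ : ℝ
  δ₁ : ℝ
  δ₀ : ℝ
  A𝒫 : ℝ
  c : ℝ
  C : ℝ
  Cℓ : ℕ → ℝ
  Cα : (Fin d → ℕ) → ℕ → ℝ
  h : ℝ
  θ : ℝ
  T₀ : ℝ
  A𝒫' : ℝ
  A : ℝ
  r : ℝ
  hh : 0 < h
  hd : 3 ≤ d
  hMord : 1 ≤ Mord
  hMR : Mord ≤ R
  hLodd : Odd L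
  hL : 2 ^ (d + 3) + 16 * R ≤ L
  hR2 : 2 ≤ R
  hθbar : 0 < θbar
  hlam : 0 < lam
  hn : 2 * Mord ≤ n
  hn2 : 2 ≤ n
  hnñ : n ≤ ñ
  hgap : d + 1 ≤ 2 * (ñ - n)
  hc : 0 < c
  hC1 : 0 ≤ Cℓ 1
  hp : d / 2 + 2 ≤ pT
  hpM : pT + d ≤ Mord
  hr₀ : 3 ≤ r₀
  hδ₀ : 0 < δ₀
  hδ₁ : 0 < δ₁
  hh0 : hZeroSq d R δ₀ δ₁ ≤ h ^ 2
  hh2 : secondDiffConst (fun θ' => Cα θ' 0) ≤ h ^ 2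
  hθ0 : 0 ≤ θ
  hθ : θ < θbar
  hT₀ : T₀ ≤ 1 / 2
  hKT₀ : shellRatioConst c (Cℓ 1) (L : ℝ) d ñ * T₀ ≤ Real.log (1 + θ)
  hA𝒫' : weightIntConstRho θbar θ (traceConst d Mord R lam (derivSum d n fun θ' _ => Cα θ' 0)) = A𝒫'
  hA1 : 1 ≤ A
  hA𝒫A : A𝒫' ≤ A
  hsmall : (2 : ℝ) ^ (L ^ d) * (A𝒫' * A ^ (-(1 - (1 + 1 / ((2 * (2 ^ d + 1) + 6 : ℝ) ^ d))⁻¹) : ℝ)) ≤ 1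
  hr0 : 0 ≤ r
  hr : r ≤ 1 / 64
  hv : vABKM d R A A𝒫' r ≤ 1 / 64
  hωA : omegaABKM d R A A𝒫' r * A ^ 2 ≤ 1
  hc3A : (kappaABKM d R A A𝒫' r) ^ (L ^ d) * ((2 * (2 * (kappaABKM d R A A𝒫' r) * max 1 A𝒫')) ^
      ((2 ^ (d + 1) + 2) ^ d * L ^ d) * (4 : ℝ) ^ ((2 ^ (d + 1) + 2) ^ d * L ^ d)) ≤
    A ^ ((1 + 1 / ((2 * (2 ^ d + 1) + 6 : ℝ) ^ d)) - 1 : ℝ)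
  hc2A : (kappaABKM d R A A𝒫' r) ^ (L ^ d) * ((2 * (kappaABKM d R A A𝒫' r) * max 1 A𝒫') ^
      ((2 ^ (d + 1) + 2) ^ d * L ^ d) * (2 : ℝ) ^ ((2 ^ (d + 1) + 2) ^ d * L ^ d)) ≤
    A ^ ((1 + 1 / ((2 * (2 ^ d + 1) + 6 : ℝ) ^ d)) - 1 : ℝ)

/-- **`PackageAt P N M`** — the height-`N` data of the package `P` on the torus `(ℤ/M)^d`, `M = L^N`,
`N ≥ 1`: the finite-range decomposition `𝒞_{A,k}` of every elliptic `A` with its top-momentum constants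
`Mc` and the clauses (o)–(v) of `GradientFRD.TorusFRD d` (verbatim the hypothesis `hallA` of
`GradientRG.exists_tuned_initial_of_torusFRD`), and the weight tower of Theorem 7.1 for `𝒞_{1,·}`
(`AbkmWeightBounds`, hypothesis `hB`).  Pure bundling. [cite: AdamsBuchholzKoteckyMuller2019, Thm 6.1 / Thm 7.1; Buchholz2016, Thm 2.4] -/
structure PackageAt {d : ℕ} (P : PackageData d) (N M : ℕ) [NeZero M] where
  𝒞 : Matrix (Fin d) (Fin d) ℝ → ℕ → (Fin d → ZMod M) → ℝ
  Mc : ℕ → ℝ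
  hN : 1 ≤ N
  hM : M = P.L ^ N
  hallA : ∀ A : Matrix (Fin d) (Fin d) ℝ, IsElliptic (1 / 2 : ℝ) 2 A →
        (∀ k, 1 ≤ k → k ≤ N + 1 →
          ∑ x : Fin d → ZMod M, 𝒞 A k x = 0 ∧ ∀ x, 𝒞 A k (-x) = 𝒞 A k x) ∧
        (∀ k, 1 ≤ k → k ≤ N + 1 → ∀ φ : (Fin d → ZMod M) → ℝ, ∑ x, φ x = 0 →
          0 ≤ ∑ x, ∑ y, φ x * 𝒞 A k (x - y) * φ y) ∧
        (∀ φ : (Fin d → ZMod M) → ℝ, ∑ x, φ x = 0 →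
          ellOp A (conv (fun x => ∑ k ∈ Finset.Icc 1 (N + 1), 𝒞 A k x) φ) = φ) ∧
        (∀ k, 1 ≤ k → k ≤ N → Mc k ≤ 0 ∧
          ∀ x : Fin d → ZMod M, ((P.L : ℝ) ^ k) / 2 ≤ (supNorm x : ℝ) →
            𝒞 A k x = Mc k) ∧
        (∀ k, 1 ≤ k → k ≤ N + 1 → ∀ B : Matrix (Fin d) (Fin d) ℝ, IsUnitSymm B →
          (∃ ε : ℝ, 0 < ε ∧ ∀ x : Fin d → ZMod M,
            ContDiffOn ℝ ⊤ (fun s : ℝ => 𝒞 (A + s • B) k x) (Set.Ioo (-ε) ε)) ∧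
          ∀ α : Fin d → ℕ, ∑ i, α i ≤ P.n → ∀ ℓ : ℕ, ∀ x : Fin d → ZMod M,
            abs (iteratedDeriv ℓ (fun s : ℝ => iterDiff α (𝒞 (A + s • B) k) x) 0)
              ≤ P.Cα α ℓ / (P.L : ℝ) ^ ((k - 1) * (d - 2 + ∑ i, α i))) ∧
        (∀ k, 1 ≤ k → k ≤ N + 1 → ∀ j : ℕ, ∀ κ : Fin d → ZMod M, κ ≠ 0 → InShell P.L j κ →
          (j < k →
            P.c / (P.L : ℝ) ^ (2 * (d + P.ñ) + 1) * (P.L : ℝ) ^ (2 * j)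
                / (P.L : ℝ) ^ ((k - j) * (d - 1 + P.n)) ≤ (fourierCoeff (𝒞 A k) κ).re ∧
            ‖fourierCoeff (𝒞 A k) κ‖
              ≤ P.C * (P.L : ℝ) ^ (2 * (d + P.ñ) + 1) * (P.L : ℝ) ^ (2 * j)
                  / (P.L : ℝ) ^ ((k - j) * (d - 1 + P.n))) ∧
          (k ≤ j →
            P.c / (P.L : ℝ) ^ (2 * (d + P.ñ) + 1) * (P.L : ℝ) ^ (2 * k)
                ≤ (fourierCoeff (𝒞 A k) κ).re ∧
            ‖fourierCoeff (𝒞 A k) κ‖ ≤ P.C * (P.L : ℝ) ^ (2 * k)) ∧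
          ∀ B : Matrix (Fin d) (Fin d) ℝ, IsUnitSymm B → ∀ ℓ : ℕ, 1 ≤ ℓ →
            (j < k →
              ‖iteratedDeriv ℓ (fun s : ℝ => fourierCoeff (𝒞 (A + s • B) k) κ) 0‖
                ≤ P.Cℓ ℓ * (P.L : ℝ) ^ (2 * (d + P.ñ) + 1) * (P.L : ℝ) ^ (2 * j)
                    / (P.L : ℝ) ^ ((k - j) * (d - 1 + P.ñ))) ∧
            (k ≤ j →
              ‖iteratedDeriv ℓ (fun s : ℝ => fourierCoeff (𝒞 (A + s • B) k) κ) 0‖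
                ≤ P.Cℓ ℓ * (P.L : ℝ) ^ (2 * k)))
  hB : AbkmWeightBounds P.L N P.Mord P.R P.n P.θbar P.lam P.μ P.δ₁ P.δ₀ P.A𝒫 (fun j => 𝒞 1 j)
      (abkmWeightData P.L N P.Mord P.R P.θbar (schedDelta P.δ₀ P.δ₁ N) fun j => 𝒞 1 j)

/-! ## Abbreviations of record (memo §0): `P`, `𝒞s_q`, `B_q`, `S_q`, `Φ_q`, the ball, `|·|₁` -/

namespace PackageData

variable {d : ℕ}

/-- The tuning ball `Ball q :↔ q symmetric ∧ Σ|q_ij| ≤ T₀`. [cite: AdamsBuchholzKoteckyMuller2019, Lemma 12.6] -/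
def InBall (P : PackageData d) (q : Matrix (Fin d) (Fin d) ℝ) : Prop :=
  q.IsSymm ∧ ∑ i, ∑ j, |q i j| ≤ P.T₀

end PackageData

/-- The entry-sum size `|m|₁ = Σ_{ij} |m_ij|` of a `d × d` matrix (the distance of record on tuning
parameters). [cite: AdamsBuchholzKoteckyMuller2019, Lemma 12.6 (12.51)] -/
def esum {d : ℕ} (m : Matrix (Fin d) (Fin d) ℝ) : ℝ := ∑ i, ∑ j, |m i j|

namespace PackageAt

variable {d : ℕ} {P : PackageData d} {N M : ℕ} [NeZero M]

/-- `P = abkmNormParams …` of the package at height `N` (the norm parameters of Ch. 6–8 for `𝒞_{1,·}`; plumbing). [cite: AdamsBuchholzKoteckyMuller2019, Thm 7.1 / Ch. 8] -/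
abbrev normParams (Q : PackageAt P N M) : NormParams d M :=
  abkmNormParams P.L N P.Mord P.R P.pT P.r₀ P.h P.θbar P.A (schedDelta P.δ₀ P.δ₁ N) fun j => Q.𝒞 1 j

/-- The step-kernel family `𝒞s_q = (j ↦ 𝒞_{1+q, j})` of the tuning parameter `q` (plumbing). [cite: AdamsBuchholzKoteckyMuller2019, Ch. 12 (12.50)] -/
abbrev kernels (Q : PackageAt P N M) (q : Matrix (Fin d) (Fin d) ℝ) : ℕ → (Fin d → ZMod M) → ℝ :=
  fun j => Q.𝒞 ((1 : Matrix (Fin d) (Fin d) ℝ) + q) j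

/-- `B_k^{(q)}` — `rgBT` of the package at the tuning parameter `q` (total in `q`; `= rgBQ` on the ball; plumbing). [cite: AdamsBuchholzKoteckyMuller2019, Thm 6.8 / (6.40)] -/
abbrev opB (Q : PackageAt P N M) (q : Matrix (Fin d) (Fin d) ℝ) (k : ℕ) :
    activitySpace Q.normParams k →+
      HamSpace ℂ d (fieldWt P.h (P.L : ℝ) d (k + 1)) ((P.L : ℝ) ^ (k + 1)) (P.L ^ (d * (k + 1))) :=
  rgBT (h := P.h) P.hd P.hMord P.hMR P.hLodd P.hL Q.hM P.hθbar P.hlam P.hn P.hn2 P.hnñ P.hc P.hC1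
    Q.hallA Q.hB P.pT P.r₀ P.hr₀ P.A P.hθ0 P.hθ P.hT₀ P.hKT₀ q k

/-- `S_k^{(q)}(u, v)` — `rgSQ` of the package for the family `𝒞s_q` (plumbing). [cite: AdamsBuchholzKoteckyMuller2019, Thm 6.8 / (6.40)] -/
abbrev opS (Q : PackageAt P N M) (q : Matrix (Fin d) (Fin d) ℝ) (k : ℕ)
    (u : HamSpace ℂ d (fieldWt P.h (P.L : ℝ) d k) ((P.L : ℝ) ^ k) (P.L ^ (d * k)))
    (v : activitySpace Q.normParams k) : activitySpace Q.normParams (k + 1) :=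
  rgSQ (L := P.L) (N := N) (Mord := P.Mord) (R := P.R) (p := P.pT) (r₀ := P.r₀) (h := P.h)
    (θbar := P.θbar) (A := P.A) (δ₀ := P.δ₀) (δ₁ := P.δ₁) (𝒞 := fun j => Q.𝒞 1 j) (Q.kernels q) k u v

/-- The last-scale functional `Φ_q(y) = ∫ y(Λ_N, φ) μ_{𝒞_{1+q,N+1}}(dφ)` (`TunedFlowLastScale`; the `1 +`
of `I = 1 + Φ` cancels in differences; plumbing). [cite: AdamsBuchholzKoteckyMuller2019, Ch. 4 (4.12) / Ch. 12 (12.6)] -/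
abbrev lastScale (Q : PackageAt P N M) (q : Matrix (Fin d) (Fin d) ℝ)
    (y : activitySpace Q.normParams N) : ℂ :=
  ∫ φ, (y : Finset (Fin d → ZMod M) → ((Fin d → ZMod M) → ℝ) → ℂ) Finset.univ φ
    ∂(stepMeasure (Q.𝒞 ((1 : Matrix (Fin d) (Fin d) ℝ) + q) (N + 1)))

end PackageAt

/-! ## The nine `q`-slots (memo §1) and the state slot (memo §2), each in a free size variable -/

section Slots

variable {d : ℕ} (P : PackageData d) [Fact (0 < P.h)] [Fact (0 < P.L)] {N M : ℕ} [NeZero M]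
  (Q : PackageAt P N M)

/-- **(F4a)** `‖A_q'⁻¹ − A_q⁻¹‖ ≤ a_T |q' − q|₁` on the ball, all steps `k + 1 ≤ N` ((12.51) in `q`; in
the tree `N`-free: `norm_rgA_symm_one_add_sub_le_of_torusFRD`). [cite: AdamsBuchholzKoteckyMuller2019, Lemma 12.6 (12.51)] -/
def F4a (aT : ℝ) : Prop :=
  ∀ q q' : Matrix (Fin d) (Fin d) ℝ, P.InBall q → P.InBall q' → ∀ k, k + 1 ≤ N →
    ∀ w : HamSpace ℂ d (fieldWt P.h (P.L : ℝ) d (k + 1)) ((P.L : ℝ) ^ (k + 1)) (P.L ^ (d * (k + 1))),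
      ‖(rgA P.L P.h (Q.kernels q') k).symm w - (rgA P.L P.h (Q.kernels q) k).symm w‖ ≤
        aT * esum (q' - q) * ‖w‖

/-- **(F4b)** `‖B_q' v − B_q v‖ ≤ b_T |q' − q|₁ ‖v‖` on the ball ((12.52) in `q`; `N`-free in the tree:
`norm_rgBQ_sub_le_unif_of_torusFRD` with `rgBT_of_mem`). [cite: AdamsBuchholzKoteckyMuller2019, Lemma 12.6 (12.52)] -/
def F4b (bT : ℝ) : Prop :=
  ∀ q q' : Matrix (Fin d) (Fin d) ℝ, P.InBall q → P.InBall q' → ∀ k, k + 1 ≤ N →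
    ∀ (v : activitySpace Q.normParams k) (cv : ℝ), activityNormLE Q.normParams k v cv →
      ‖Q.opB q' k v - Q.opB q k v‖ ≤ bT * esum (q' - q) * cv

/-- **(F4l)** the `S_k` two-kernel comparison (12.53) in the tuning parameter — VERBATIM the hypothesis
`hl` of `GradientRG.exists_tuned_initial_of_torusFRD` with the size `l_T` free. [cite: AdamsBuchholzKoteckyMuller2019, Lemma 12.6 (12.53)] -/
def F4l (lT : ℝ) : Prop :=
  ∀ q q' : Matrix (Fin d) (Fin d) ℝ, P.InBall q → P.InBall q' → ∀ k, k + 1 ≤ N →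
    ∀ (u : HamSpace ℂ d (fieldWt P.h (P.L : ℝ) d k) ((P.L : ℝ) ^ k) (P.L ^ (d * k)))
      (v : activitySpace Q.normParams k) (cv : ℝ), ‖u‖ ≤ P.r →
      activityNormLE Q.normParams k v cv → cv ≤ P.r →
      activityNormLE Q.normParams (k + 1) (Q.opS q k u v - Q.opS q' k u v)
        (lT * esum (q - q') * max ‖u‖ cv)

/-- **(F4a2)** mixed second differences of `q ↦ A_q⁻¹` on parallelograms in the ball (`ℓ = 2`; `N`-free
in the tree: `norm_rgA_symm_secondDiff_le_of_torusFRD`). [cite: AdamsBuchholzKoteckyMuller2019, Lemma 8.4 / Lemma 12.6] -/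
def F4a2 (aTT : ℝ) : Prop :=
  ∀ q y z : Matrix (Fin d) (Fin d) ℝ, P.InBall q → P.InBall (q + y) → P.InBall (q + z) →
    P.InBall (q + y + z) → ∀ k, k + 1 ≤ N →
    ∀ w : HamSpace ℂ d (fieldWt P.h (P.L : ℝ) d (k + 1)) ((P.L : ℝ) ^ (k + 1)) (P.L ^ (d * (k + 1))),
      ‖(rgA P.L P.h (Q.kernels (q + y + z)) k).symm w - (rgA P.L P.h (Q.kernels (q + y)) k).symm w
          - (rgA P.L P.h (Q.kernels (q + z)) k).symm w + (rgA P.L P.h (Q.kernels q) k).symm w‖ ≤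
        aTT * esum y * esum z * ‖w‖

/-- **(F4b2)** mixed second differences of `q ↦ B_q v` (`ℓ = 2`; first-order half in the tree,
`hamNorm_opB_mid_sub_unif_of_torusFRD`; the second-order half is the `ℓ = 2` Gaussian engine). [cite: AdamsBuchholzKoteckyMuller2019, Lemma 8.4 / Lemma 12.6] -/
def F4b2 (bTT : ℝ) : Prop :=
  ∀ q y z : Matrix (Fin d) (Fin d) ℝ, P.InBall q → P.InBall (q + y) → P.InBall (q + z) →
    P.InBall (q + y + z) → ∀ k, k + 1 ≤ N →
    ∀ (v : activitySpace Q.normParams k) (cv : ℝ), activityNormLE Q.normParams k v cv →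
      ‖Q.opB (q + y + z) k v - Q.opB (q + y) k v - Q.opB (q + z) k v + Q.opB q k v‖ ≤
        bTT * esum y * esum z * cv

/-- **(F4l2)** mixed second differences of `q ↦ S_q(u, v)` in the activity norm (`ℓ = 2` of (12.53)). [cite: AdamsBuchholzKoteckyMuller2019, Lemma 8.4 / Lemma 12.6 (12.53)] -/
def F4l2 (lTT : ℝ) : Prop :=
  ∀ q y z : Matrix (Fin d) (Fin d) ℝ, P.InBall q → P.InBall (q + y) → P.InBall (q + z) →
    P.InBall (q + y + z) → ∀ k, k + 1 ≤ N →
    ∀ (u : HamSpace ℂ d (fieldWt P.h (P.L : ℝ) d k) ((P.L : ℝ) ^ k) (P.L ^ (d * k)))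
      (v : activitySpace Q.normParams k) (cv : ℝ), ‖u‖ ≤ P.r →
      activityNormLE Q.normParams k v cv → cv ≤ P.r →
      activityNormLE Q.normParams (k + 1)
        (Q.opS (q + y + z) k u v - Q.opS (q + y) k u v - Q.opS (q + z) k u v + Q.opS q k u v)
        (lTT * esum y * esum z * max ‖u‖ cv)

/-- **(F4l')** the `q`-difference of `S_k` is Lipschitz in the state: `‖(S_q' − S_q)(u,v) − (S_q' − S_q)(u',v')‖
≤ l_T' |q' − q|₁ max(‖u − u'‖, ‖v − v'‖)` (mixed `q`/state slot of the `C^{1,1}` tuned seed). [cite: AdamsBuchholzKoteckyMuller2019, Lemma 12.6 (12.53) / Ch. 12] -/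
def F4l' (lT' : ℝ) : Prop :=
  ∀ q q' : Matrix (Fin d) (Fin d) ℝ, P.InBall q → P.InBall q' → ∀ k, k + 1 ≤ N →
    ∀ (u u' : HamSpace ℂ d (fieldWt P.h (P.L : ℝ) d k) ((P.L : ℝ) ^ k) (P.L ^ (d * k)))
      (v v' : activitySpace Q.normParams k) (cv cv' cd : ℝ), ‖u‖ ≤ P.r → ‖u'‖ ≤ P.r →
      activityNormLE Q.normParams k v cv → cv ≤ P.r → activityNormLE Q.normParams k v' cv' →
      cv' ≤ P.r → activityNormLE Q.normParams k (v - v') cd →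
      activityNormLE Q.normParams (k + 1)
        ((Q.opS q' k u v - Q.opS q k u v) - (Q.opS q' k u' v' - Q.opS q k u' v'))
        (lT' * esum (q' - q) * max ‖u - u'‖ cd)

/-- **(F4Φ2)** the last-scale functional is Lipschitz in `q` on the ball: `‖Φ_q(y) − Φ_q'(y)‖ ≤ φ_T |q − q'|₁ ‖y‖`
(`N`-free in the tree: `norm_integral_last_kernel_sub_le_of_torusFRD`; gives `hΦ2` AND `hΦ12` since `Φ_q` is
linear in `y`). [cite: AdamsBuchholzKoteckyMuller2019, Lemma 8.4 (last scale)] -/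
def F4Φ2 (φT : ℝ) : Prop :=
  ∀ q q' : Matrix (Fin d) (Fin d) ℝ, P.InBall q → P.InBall q' →
    ∀ (y : activitySpace Q.normParams N) (cy : ℝ), activityNormLE Q.normParams N y cy → cy ≤ P.r →
      ‖Q.lastScale q y - Q.lastScale q' y‖ ≤ φT * esum (q - q') * cy

/-- **(F4Φ22)** mixed second differences of `q ↦ Φ_q(y)` on parallelograms in the ball (`ℓ = 2`; first-order
half in the tree, the second-order half is the `ℓ = 2` Gaussian engine). [cite: AdamsBuchholzKoteckyMuller2019, Lemma 8.4 (last scale)] -/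
def F4Φ22 (φTT : ℝ) : Prop :=
  ∀ q y z : Matrix (Fin d) (Fin d) ℝ, P.InBall q → P.InBall (q + y) → P.InBall (q + z) →
    P.InBall (q + y + z) →
    ∀ (y₀ : activitySpace Q.normParams N) (c : ℝ), activityNormLE Q.normParams N y₀ c → c ≤ P.r →
      ‖Q.lastScale (q + y + z) y₀ - Q.lastScale (q + y) y₀ - Q.lastScale (q + z) y₀ + Q.lastScale q y₀‖ ≤
        φTT * esum y * esum z * c

/-- **(H1σ2)** joint second differences of `(u, v) ↦ S_q(u, v)` in the state at FIXED `q` in the ball,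
all steps `k + 1 ≤ N`, `N`-free size `σ₂` — verbatim `hσ2` of `exists_freeEnergy_of_package` at the level of
`q` (the model-specific discharge of the landed holomorphic toolchain, census S6c). [cite: AdamsBuchholzKoteckyMuller2019, Thm 6.8 (smoothness of S) / Ch. 12] -/
def H1σ2 (σ₂ : ℝ) : Prop :=
  ∀ q : Matrix (Fin d) (Fin d) ℝ, P.InBall q → ∀ k, k + 1 ≤ N →
    ∀ (u y z : HamSpace ℂ d (fieldWt P.h (P.L : ℝ) d k) ((P.L : ℝ) ^ k) (P.L ^ (d * k)))
      (v y' z' : activitySpace Q.normParams k) (cv cvy cvz cvyz cy cz : ℝ),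
      ‖u‖ ≤ P.r → ‖u + y‖ ≤ P.r → ‖u + z‖ ≤ P.r → ‖u + y + z‖ ≤ P.r →
      activityNormLE Q.normParams k v cv → cv ≤ P.r →
      activityNormLE Q.normParams k (v + y') cvy → cvy ≤ P.r →
      activityNormLE Q.normParams k (v + z') cvz → cvz ≤ P.r →
      activityNormLE Q.normParams k (v + y' + z') cvyz → cvyz ≤ P.r →
      activityNormLE Q.normParams k y' cy → activityNormLE Q.normParams k z' cz →
      activityNormLE Q.normParams (k + 1)
        (Q.opS q k (u + y + z) (v + y' + z') - Q.opS q k (u + y) (v + y') - Q.opS q k (u + z) (v + z') +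
          Q.opS q k u v)
        (σ₂ * max ‖y‖ cy * max ‖z‖ cz)

end Slots

/-! ## The named facts = bundles with the sizes bound BEFORE `∀ N` (`N`-uniformity) -/

/-- **`F4Statement d`** (memo §3): for every package, `N`-FREE sizes for all nine `q`-slots at every height.
[cite: AdamsBuchholzKoteckyMuller2019, Lemma 12.6 (12.51)–(12.53) / Lemma 8.4] -/
def F4Statement (d : ℕ) : Prop :=
  ∀ (P : PackageData d) [Fact (0 < P.h)] [Fact (0 < P.L)],
    ∃ aT bT lT aTT bTT lTT lT' φT φTT : ℝ, 0 ≤ aT ∧ 0 ≤ bT ∧ 0 ≤ lT ∧ 0 ≤ aTT ∧ 0 ≤ bTT ∧ 0 ≤ lTT ∧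
      0 ≤ lT' ∧ 0 ≤ φT ∧ 0 ≤ φTT ∧
      ∀ (N M : ℕ) [NeZero M] (Q : PackageAt P N M),
        F4a P Q aT ∧ F4b P Q bT ∧ F4l P Q lT ∧ F4a2 P Q aTT ∧ F4b2 P Q bTT ∧ F4l2 P Q lTT ∧
          F4l' P Q lT' ∧ F4Φ2 P Q φT ∧ F4Φ22 P Q φTT

/-- **`H1bcStatement d`** (memo §3; census F5 = H1b/H1c): for every package, an `N`-FREE joint state second
difference size `σ₂` of `S_q` at every height (the last-scale state slots `hΦ1/hΦ4` are linearity, in the tree).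
[cite: AdamsBuchholzKoteckyMuller2019, Thm 6.8 / Ch. 12] -/
def H1bcStatement (d : ℕ) : Prop :=
  ∀ (P : PackageData d) [Fact (0 < P.h)] [Fact (0 < P.L)],
    ∃ σ₂ : ℝ, 0 ≤ σ₂ ∧ ∀ (N M : ℕ) [NeZero M] (Q : PackageAt P N M), H1σ2 P Q σ₂

/-- **`TwoKernelSkBound d`** — census (C3c-v), the `N`-FREE `S_k` two-kernel comparison: for every package an
`N`-free `l_T` with (F4l) at every height.  The tree has (F4l) with an `N`-DEPENDENT constant
(`exists_activityNormLE_rgSQ_sub_of_torusFRD`, Brouwer-grade counting); the `N`-free version is the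
Banach-grade two-kernel bound (twins of the Theorem 6.8 contraction files with the per-connected-polymer pair
property; first piece in the tree: `weakNormLE_opC_sub_unif_of_torusFRD`). [cite: AdamsBuchholzKoteckyMuller2019, Lemma 12.6 (12.53) / Thm 6.8] -/
def TwoKernelSkBound (d : ℕ) : Prop :=
  ∀ (P : PackageData d) [Fact (0 < P.h)] [Fact (0 < P.L)],
    ∃ lT : ℝ, 0 ≤ lT ∧ ∀ (N M : ℕ) [NeZero M] (Q : PackageAt P N M), F4l P Q lT

/-- **`L2GaussianCore d`** — the two `ℓ = 2` slots that need ONLY the second-order Gaussian fluctuation engine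
(small-step core `GaussianCovarianceComparisonTraceSecond` + subdivision + Taylor-norm plumbing): `N`-free sizes
for (F4b2) and (F4Φ22) at every height. [cite: AdamsBuchholzKoteckyMuller2019, Lemma 8.4 (ℓ = 2)] -/
def L2GaussianCore (d : ℕ) : Prop :=
  ∀ (P : PackageData d) [Fact (0 < P.h)] [Fact (0 < P.L)],
    ∃ bTT φTT : ℝ, 0 ≤ bTT ∧ 0 ≤ φTT ∧
      ∀ (N M : ℕ) [NeZero M] (Q : PackageAt P N M), F4b2 P Q bTT ∧ F4Φ22 P Q φTT

end Literature.MathematicalPhysics.StatisticalMechanics.GradientRG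

end
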